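import Summits.QuantumFields.YangMills.Theorems.BalabanUVNodesN07CoarseGaugeQForm
import Literature.MathematicalPhysics.QuantumFieldTheory.BalabanImbrieJaffe1984to88.BIJ85GaugeFnBound513
import HarnessLib

/-!
# N07 [B11] (= [15] = [Balaban1985Variational]) Sect. F, road of record R0′, WIDTH-209 row (r2), FILE 6: **THE S6 HEAD's R0′ SPLIT CLAUSE FOR A COARSE
# FAMILY THAT IS NOT OUTER-CONSISTENT** — the shift is the `Q(∂M)`-part `X_Q` of the datum (curl-free under `H_V`, FILE 3), the remainder `X_∂ = X − X_Q`
# (FILE 5: supported on the outer `Λ_j`-cells) is FOLDED INTO `A₀` through dag-n07-w4's `Letters10On.add`; at NODE 00's four-tori its letters come from the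
# uniform door (FILE 3 §2) once the family's outer defect `λ_j(y_out) − Q′_jμ(y_out)` is `≤ ς_∂` — and for the level lift `μ_λ` that bound is `2·sup‖λ_j‖` from SIZES ALONE (§1c) — so the head's
# clause needs NO `hout` at the record, only the (r4) size of the shear

Cell `pub-ymgap`, width seat `pub-ymgap-dag-n07-w8` g3, WIDTH-209 N07 row (r2) of road R0′, CLAIM-6 ∕ INTENT-6 (cell bus I.35273; own lineage FILE 5 p621432 ✓ → FILE 6).
`--kind proof --supports stmt-QuantumFields-26907 --as helper` (K1⁸); count-neutral; def-free.
[15] = T. Bałaban, Commun. Math. Phys. **102** (1985) 277–309 [Balaban1985Variational]; [6] = [Balaban1985RegularSpaces] (CMP **99** (1985) 75–102); [4] =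
[Balaban1984PropagatorsII] (CMP **96** (1984) 223–250); [I.4] = [Balaban1984PropagatorsI] (CMP **95** (1984) 17–40).

THE POINT.  The S6 head's per-datum R0′ assembly (dag-n07-w4 `S6-HEAD-RECIPE.md` § UPDATE g3) reads the sheared datum `B‴ = B″ + ∂_cλ + N₂` (rows (r0)∕(r1)) and wants the
shift `G := H_V(∂_cλ)` CURL-FREE (p612997) so that only [6] (1.54)'s quadratic term sees it (g0 p609716).  FILE 5 showed: `H_V(∂_cλ)` is curl-free as soon as the family
`λ` is OUTER-CONSISTENT (`λ_j(y_out) = Q′_jμ_λ(y_out)` at the outer end-points of the `Λ_j`-cells of [4] (2.3)), and in general `∂(H_V X) = ∂(H_V X_∂)` with the defect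
datum `X_∂ = X − Q(∂μ_λ)` supported on the outer cells.  THIS FILE books the general case in the head's clause: `G := H_V X_Q` is the shift, `H_V X_∂` joins `A₀`
(its three (165)-letters add to `A₀`'s by `Letters10On.add`), and at NODE 00's objects the letters of `H_V X_∂` come from FILE 3's uniform door
`letters10On_extension_of_uniformDatum_adm22_T4` once `‖X_∂(c)‖ ≤ ς_∂·L^{k−j(c)}` — which §1's `norm_sub_bondAvgIter_grad_le_of_outerDefect_le` derives from a bound
`ς_∂` on the family's outer defect.  For outer-consistent ∕ block-mean families `ς_∂ = 0` and every `t_∂ > 0` works.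

WHAT IS PROVED (sorry-free; no definition; axioms standard; all BY NAME).
* §1 (generic `P : Params`, lattice level `k`, tower `D`) ★★ `localGaugeSplitOn_of_eq159_coarseShift_sub` — (159) FORM: gauge equation for `A₀ + H_V X` on `Y`, `A₀ = A₁ + A₂ − A₃`
  with `Letters10On` letters `t₁, t₂, t₃`, ANY fine matrix `M`, letters `t_Q` of `H_V X_Q` (`X_Q(c) = (Q_{j(c)}(∂^{Lᵏ}M))(c)`) and `t_∂` of `H_V(X − X_Q)` ⇒
  `LocalGaugeSplitOn Y η_k (t₁ + (t₂ + t_∂) + t₃ + t_Q) (t₁ + (t₂ + t_∂) + t₃) U` (∘ dag-n07-w4 `localGaugeSplitOn_of_eq159`, FILE 3 `curlA_extension_eq_zero_of_bondAvgIter_grad`,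
  `Letters10On.add`); ★★ `localGaugeSplitOn_of_gauge152_coarseShift_sub` — S3 (152) FORM: full-potential letters `t`, `A − H_V X = A₁ + A₂ − A₃`, letters `t_∂` of
  `H_V(X − X_Q)` ⇒ `LocalGaugeSplitOn Y η_k t (t₁ + (t₂ + t_∂) + t₃) U` (∘ `localGaugeSplitOn_of_gauge152_eq159`); ★ `norm_sub_bondAvgIter_grad_le_of_outerDefect_le`
  (values in a real normed space; FILE 5 §3: if `Q′_jμ = λ_j` on the `Λ_j`, `D.k ≤ k`, and `‖λ_j(y_out) − Q′_jμ(y_out)‖ ≤ ς_∂` at every outer end-point, then the defect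
  datum of the coarse gradient `X(c) = ∂^{(j(c))}λ_{j(c)}(c)` (factor `Lᵏ∕L^{j(c)}`) obeys `‖X(c) − (Q(∂^{Lᵏ}μ))(c)‖ ≤ ς_∂·L^{k−j(c)}` — the shape of FILE 3 §2's door).
* §1c SIZES ALONE SUFFICE: `norm_siteAvgIter_le_of_forall_le` (`Q′_j` a convex combination, lit-balaban `norm_siteAvg_le` iterated), `norm_levLift_le` (`‖μ_λ‖ ≤ sup_{Λ}‖λ‖`),
  ★ `norm_sub_siteAvgIter_levLift_le` ∕ ★ `outerDefect_levLift_le_of_norm_le` (the outer defect of FILE 5's level lift is `≤ s + s` from `‖λ_j‖ ≤ s` on the `Λ_j`-sites and at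
  the outer end-points — NO consistency asked; for the record's shear family `s = 2σ` from row (r4), so `ς_∂ = 4σ`: first order in the shear, as LOCATED-QFORM said).
* §2 (NODE 00's four-tori) ★★ `localGaugeSplitOn_of_gauge152_coarseShift_outerDefect_adm22_T4 F N` — §1 ∘ FILE 3 §2: there are `M_h⁰, R₀`, `C ≥ 0`, `δ₀, δ₁, B₃ > 0` such that
  for every height, admissible tower (`Adm22`), window `Y` of top-level sites, componentwise extension `H_V` of `flatH`, family `λ` with a `μ` reproducing it on the `Λ_j` and
  outer defect `≤ ς_∂`, datum `X` the coarse gradient of `λ`, S3's (152) gauge of the full potential with letters `t` and (159)-splitting `A − H_V X = A₁ + A₂ − A₃` with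
  letters `t₁, t₂, t₃`: `LocalGaugeSplitOn Y η_{K−n} t (t₁ + (t₂ + t_∂) + t₃) U` for EVERY `t_∂ > 2CB₃ς_∂`.
HONEST SCOPE.  Count-neutral ∃-packaging of landed theorems; DISPLAYED, not discharged: S3's gauge and (152) letters, the (159)-splitting and the three summands' letters,
the size `ς_∂` of the record family's outer defect (a letter of the shear recursion — rows (r4)∕(r4-rec), LOCATED, not typed), P12's tower∕window hypotheses.  Nothing of
[15]∕[6]∕[4] ANALYSIS asserted; `LocalLettersSplitTopStepCore` ∕ `DatumGaugeSplitTopStepCore` ∕ `HalvingStepTop(Core)` ∕ `stub_prop8StepCoP13` NOT discharged; K0⁷ ∕ K1⁸ NOT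
closed; N07 NOT discharged; counts unmoved (typed 28∕28 · discharged 5∕27); one finite 𝕋⁴ programme at fixed ε — the route closes the conditional finite-𝕋⁴ rung
`BalabanLadder.UV` ONLY; the YM mass gap (Clay) is NOT proved by any of this; nothing continuum ∕ ℝ⁴ ∕ OS.  No `sorry`, no `def`, no `instance`, no `notation`.

RELATED IN THE TREE, NOT DUPLICATED (stem check 2026-08-28T09:33Z: `ls …/Theorems | rg -i CoarseShift` = ∅; `rg 'coarseShift_sub|outerDefect'` over lean∕ = ∅): dag-n07-w4
`N07LocalLettersSplitCore` (the clause and its doors — CONSUMED) ∕ `N07LocalLettersCoreOfDatumGauges` (`Letters10On.add` — CONSUMED); FILE 3 `N07PureGaugeShiftLetters` (curl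
binder, uniform door — CONSUMED); FILE 4 `N07SplitClauseOfPureGaugeShift` (the clause for a datum that IS `Q(∂M)` — the case `X_∂ = 0`); FILE 5 `N07CoarseGaugeQForm` (lift,
defect, outer-consistency — CONSUMED).

References: [15] (152) p. 301, (157)–(159) pp. 302–303, (164)–(165) p. 304, (168) p. 304; [6] (1.2) p. 76, (1.54) p. 85; [4] (2.3) p. 224, (2.35) p. 228, (2.60) p. 234,
Cor. 2.8 (2.150)–(2.151) p. 249; [I.4] (1.20) p. 20.
-/

set_option autoImplicit false

noncomputable section
open scoped BigOperators Matrix.Norms.L2Operator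

namespace Summit.QuantumFields.YangMills.BalabanUVNodes.N07SplitClauseOfCoarseShift

open Literature.MathematicalPhysics.QuantumFieldTheory.Balaban1983to89
open Literature.MathematicalPhysics.QuantumFieldTheory.Balaban1983to89.Node00
open Literature.MathematicalPhysics.QuantumFieldTheory.Balaban1983to89.B12RegularSpaces111 (gaugeU expI grad)
open LatticeFieldCalculus (siteAvg siteAvgIter bondAvgIter)
open B5Eq118OneStroke (iterBlockOf)
open B5Eq120IterProof (siteAvgIter_succ)
open B11Eq115Space (levOf)
open Summit.QuantumFields.YangMills.Theorems.FlatCubeLevels (lamSite_levOf_inOm)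
open Literature.MathematicalPhysics.QuantumFieldTheory.BalabanImbrieJaffe1984to88.BIJ85GaugeFnBound513 (norm_siteAvg_le)
open B6SectADomainsV1 (Domains)
open B6SectAOperatorsV1 (BondIdx)
open T4Continuum (T4Family)
open Summit.QuantumFields.YangMills.Theorems.FlatCubeOpsText (Adm22)
open Summit.QuantumFields.YangMills.Theorems.K0FlatCubeOpsTextP (flatH IsLevWeight)
open Summit.QuantumFields.YangMills.BalabanUVNodes.N07HalvingStepTopOfLocalLetters (Letters10On)
open Summit.QuantumFields.YangMills.BalabanUVNodes.N07LocalLettersSplitCore (LocalGaugeSplitOn localGaugeSplitOn_of_eq159 localGaugeSplitOn_of_gauge152_eq159)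
open Summit.QuantumFields.YangMills.BalabanUVNodes.N07LocalLettersCoreOfDatumGauges (Letters10On.add)
open Summit.QuantumFields.YangMills.BalabanUVNodes.N07PureGaugeShiftLetters (curlA_extension_eq_zero_of_bondAvgIter_grad letters10On_extension_of_uniformDatum_adm22_T4)
open Summit.QuantumFields.YangMills.BalabanUVNodes.N07CoarseGaugeQForm (sub_bondAvgIter_grad_eq_zero_of_mem_Om sub_bondAvgIter_grad_of_src_not_mem
  sub_bondAvgIter_grad_of_tgt_not_mem)

variable {P : Params} {N : ℕ}

/-! ## §1  The clause with the shift `H_V X_Q` and the defect `H_V(X − X_Q)` folded into `A₀`, generic carrier -/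

section Generic

variable {k : ℕ} {D : Domains P}

/-- ★★ **THE R0′ SPLIT CLAUSE IN THE (159) FORM FOR A GENERAL DATUM, SHIFT := ITS `Q(∂M)`-PART** — dag-n07-w4's `localGaugeSplitOn_of_eq159` with `G := H_V X_Q`,
`X_Q(c) = (Q_{j(c)}(∂^{Lᵏ}M))(c)` for ANY fine matrix gauge function `M` (curl-free: FILE 3), and the defect summand `H_V(X − X_Q)` joined to `A₀`'s second summand by
`Letters10On.add`: the gauge equation for `A₀ + H_V X` on `Y`, `A₀ = A₁ + A₂ − A₃` with `Letters10On` letters `t₁, t₂, t₃`, letters `t_Q` of `H_V X_Q` and `t_∂` of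
`H_V(X − X_Q)` ⇒ `LocalGaugeSplitOn Y η_k (t₁ + (t₂ + t_∂) + t₃ + t_Q) (t₁ + (t₂ + t_∂) + t₃) U`.
[cite: Balaban1985Variational, (157)–(159) pp.302–303, (164)–(165) p.304, (168) p.304; Balaban1984PropagatorsII, (2.3) p.224, (2.35) p.228; Balaban1984PropagatorsI, (1.20) p.20; Balaban1985RegularSpaces, (1.2) p.76] -/
theorem localGaugeSplitOn_of_eq159_coarseShift_sub [NeZero N] {Y : Set (Site P 0)} {t₁ t₂ t₃ tQ tD : ℝ} {U : GaugeField P 0 (SU N)}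
    (u : GaugeTransf P 0 (SU N)) {A₀ A₁ A₂ A₃ : PBond P 0 → MatA N}
    {HV : (BondIdx D → MatA N) →ₗ[ℂ] (PBond P 0 → MatA N)}
    (hHV : ∀ (B : BondIdx D → MatA N) (b : PBond P 0), HV B b = ∑ c, ((flatH P k D (Pi.single c 1) b : ℝ) : ℂ) • B c)
    (X : BondIdx D → MatA N) (M : Site P 0 → MatA N)
    (he : ∀ b ∈ (Sect2.regionOfSet P Y).bonds, gaugeU (fun x => ιSU N (u x)) (fun b' => ιSU N (U b')) b = expI (P.eta k) ((A₀ + HV X) b))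
    (hA₀ : ∀ b, A₀ b = A₁ b + A₂ b - A₃ b)
    (h₁ : Letters10On Y (P.eta k) t₁ A₁) (h₂ : Letters10On Y (P.eta k) t₂ A₂) (h₃ : Letters10On Y (P.eta k) t₃ A₃)
    (hQL : Letters10On Y (P.eta k) tQ (HV (fun c => bondAvgIter (c.1.1 : ℕ) (LatticeFieldCalculus.grad ((P.L : ℝ) ^ k) M) c.1.2)))
    (hDL : Letters10On Y (P.eta k) tD (HV (fun c => X c - bondAvgIter (c.1.1 : ℕ) (LatticeFieldCalculus.grad ((P.L : ℝ) ^ k) M) c.1.2))) :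
    LocalGaugeSplitOn Y (P.eta k) (t₁ + (t₂ + tD) + t₃ + tQ) (t₁ + (t₂ + tD) + t₃) U := by
  set XQ : BondIdx D → MatA N := fun c => bondAvgIter (c.1.1 : ℕ) (LatticeFieldCalculus.grad ((P.L : ℝ) ^ k) M) c.1.2 with hXQ
  set XD : BondIdx D → MatA N := fun c => X c - bondAvgIter (c.1.1 : ℕ) (LatticeFieldCalculus.grad ((P.L : ℝ) ^ k) M) c.1.2 with hXD
  -- `X = X_∂ + X_Q`, hence `H_V X = H_V X_∂ + H_V X_Q`
  have hsplit : X = XD + XQ := by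
    funext c
    simp only [hXD, hXQ, Pi.add_apply, sub_add_cancel]
  have hHX : HV X = HV XD + HV XQ := by rw [hsplit, map_add]
  -- the gauge equation with `A₀′ := A₀ + H_V X_∂` and shift `H_V X_Q`
  have he' : ∀ b ∈ (Sect2.regionOfSet P Y).bonds,
      gaugeU (fun x => ιSU N (u x)) (fun b' => ιSU N (U b')) b = expI (P.eta k) (((A₀ + HV XD) + HV XQ) b) := by
    intro b hb
    rw [he b hb, hHX, add_assoc]
  have hA₀' : ∀ b, (A₀ + HV XD) b = A₁ b + (fun b => A₂ b + HV XD b) b - A₃ b := by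
    intro b
    simp only [Pi.add_apply, hA₀ b]
    abel
  exact localGaugeSplitOn_of_eq159 u he' (curlA_extension_eq_zero_of_bondAvgIter_grad hHV M (fun _ => rfl)) hA₀' h₁ (Letters10On.add h₂ hDL) h₃
    hQL.1 hQL.2.1

/-- ★★ **THE R0′ SPLIT CLAUSE FROM S3's (152)-GAUGE FOR A GENERAL DATUM, SHIFT := ITS `Q(∂M)`-PART** — dag-n07-w4's `localGaugeSplitOn_of_gauge152_eq159` with
`G := H_V X_Q` (ANY fine matrix `M`; curl-free by FILE 3) and the defect summand `H_V(X − X_Q)` joined to the second (159)-summand: S3's local gauge `u` of `U` on `Y` with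
potential `A`, the (152) letters `‖A‖ < t`, `‖∇^{η_k}A‖ < t`, the (159)-splitting `A − H_V X = A₁ + A₂ − A₃` with `Letters10On` letters `t₁, t₂, t₃`, and letters `t_∂` of
`H_V(X − X_Q)` ⇒ `LocalGaugeSplitOn Y η_k t (t₁ + (t₂ + t_∂) + t₃) U` — in this form neither the shift nor the full potential needs further letters.
[cite: Balaban1985Variational, (152) p.301, (157)–(159) pp.302–303, (165) p.304, (168) p.304; Balaban1984PropagatorsII, (2.3) p.224, (2.35) p.228; Balaban1984PropagatorsI, (1.20) p.20; Balaban1985RegularSpaces, (1.2) p.76] -/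
theorem localGaugeSplitOn_of_gauge152_coarseShift_sub [NeZero N] {Y : Set (Site P 0)} {t t₁ t₂ t₃ tD : ℝ} {U : GaugeField P 0 (SU N)}
    (u : GaugeTransf P 0 (SU N)) {A A₁ A₂ A₃ : PBond P 0 → MatA N}
    {HV : (BondIdx D → MatA N) →ₗ[ℂ] (PBond P 0 → MatA N)}
    (hHV : ∀ (B : BondIdx D → MatA N) (b : PBond P 0), HV B b = ∑ c, ((flatH P k D (Pi.single c 1) b : ℝ) : ℂ) • B c)
    (X : BondIdx D → MatA N) (M : Site P 0 → MatA N)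
    (he : ∀ b ∈ (Sect2.regionOfSet P Y).bonds, gaugeU (fun x => ιSU N (u x)) (fun b' => ιSU N (U b')) b = expI (P.eta k) (A b))
    (hA : ∀ b ∈ (Sect2.regionOfSet P Y).bonds, ‖A b‖ < t)
    (hdA : ∀ q ∈ (Sect2.regionOfSet P Y).dpairs, ‖grad (P.eta k) q.2.1 (fun y => A ⟨y, q.2.2⟩) q.1‖ < t)
    (h159 : ∀ b, A b - HV X b = A₁ b + A₂ b - A₃ b)
    (h₁ : Letters10On Y (P.eta k) t₁ A₁) (h₂ : Letters10On Y (P.eta k) t₂ A₂) (h₃ : Letters10On Y (P.eta k) t₃ A₃)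
    (hDL : Letters10On Y (P.eta k) tD (HV (fun c => X c - bondAvgIter (c.1.1 : ℕ) (LatticeFieldCalculus.grad ((P.L : ℝ) ^ k) M) c.1.2))) :
    LocalGaugeSplitOn Y (P.eta k) t (t₁ + (t₂ + tD) + t₃) U := by
  set XQ : BondIdx D → MatA N := fun c => bondAvgIter (c.1.1 : ℕ) (LatticeFieldCalculus.grad ((P.L : ℝ) ^ k) M) c.1.2 with hXQ
  set XD : BondIdx D → MatA N := fun c => X c - bondAvgIter (c.1.1 : ℕ) (LatticeFieldCalculus.grad ((P.L : ℝ) ^ k) M) c.1.2 with hXD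
  have hsplit : X = XD + XQ := by
    funext c
    simp only [hXD, hXQ, Pi.add_apply, sub_add_cancel]
  have hHX : HV X = HV XD + HV XQ := by rw [hsplit, map_add]
  -- `A − H_V X_Q = A₁ + (A₂ + H_V X_∂) − A₃`
  have h159' : ∀ b, A b - HV XQ b = A₁ b + (fun b => A₂ b + HV XD b) b - A₃ b := by
    intro b
    have hb := h159 b
    rw [hHX, Pi.add_apply] at hb
    simp only []
    -- from `A b - (HV XD b + HV XQ b) = A₁ b + A₂ b - A₃ b`
    have : A b - HV XQ b = (A b - (HV XD b + HV XQ b)) + HV XD b := by abel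
    rw [this, hb]
    abel
  exact localGaugeSplitOn_of_gauge152_eq159 u he hA hdA (curlA_extension_eq_zero_of_bondAvgIter_grad hHV M (fun _ => rfl)) h159' h₁ (Letters10On.add h₂ hDL) h₃

end Generic

/-! ## §1b  The level-uniform size of the defect datum from a bound on the family's outer defect -/

section DefectSize

variable {W : Type*} [NormedAddCommGroup W] [NormedSpace ℝ W]
variable {k : ℕ} {D : Domains P} {lam : (j : ℕ) → Site P j → W} {μ : SiteField P 0 W}

/-- ★ **THE DEFECT DATUM HAS THE LEVEL-UNIFORM SHAPE OF THE UNIFORM DOOR**: if `Q′_jμ = λ_j` on the `Λ_j` (sites), the tower's top level is `≤ k`, and at every OUTER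
end-point `y_out ∉ Ω_j^{(j)}` of a `Λ_j`-cell `‖λ_j(y_out) − Q′_jμ(y_out)‖ ≤ ς_∂`, then the coarse gradient `X(c) = ∂^{(j(c))}λ_{j(c)}(c)` (factor `Lᵏ∕L^{j(c)}`) satisfies
`‖X(c) − (Q_{j(c)}(∂^{Lᵏ}μ))(c)‖ ≤ ς_∂·L^{k−j(c)}` on all of `𝔅` (FILE 5 §3: zero on interior cells, `±(Lᵏ∕Lʲ)•(λ_j(y_out) − Q′_jμ(y_out))` on outer cells).
[cite: Balaban1984PropagatorsII, (2.3) p.224, (2.60) p.234; Balaban1984PropagatorsI, (1.20) p.20; Balaban1985Variational, (161) p.303] -/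
theorem norm_sub_bondAvgIter_grad_le_of_outerDefect_le (hμ : ∀ (j : ℕ) (y : Site P j), D.LamSite j y → siteAvgIter j μ y = lam j y)
    (hk : D.k ≤ k) {X : BondIdx D → W}
    (hX : ∀ c : BondIdx D, X c = LatticeFieldCalculus.grad ((P.L : ℝ) ^ k / (P.L : ℝ) ^ (c.1.1 : ℕ)) (lam c.1.1) c.1.2)
    {ςD : ℝ} (hς : 0 ≤ ςD)
    (hout : ∀ c : BondIdx D,
      (c.1.2.src ∉ D.Om c.1.1 → ‖lam c.1.1 c.1.2.src - siteAvgIter (c.1.1 : ℕ) μ c.1.2.src‖ ≤ ςD) ∧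
      (c.1.2.tgt ∉ D.Om c.1.1 → ‖lam c.1.1 c.1.2.tgt - siteAvgIter (c.1.1 : ℕ) μ c.1.2.tgt‖ ≤ ςD))
    (c : BondIdx D) :
    ‖X c - bondAvgIter (c.1.1 : ℕ) (LatticeFieldCalculus.grad ((P.L : ℝ) ^ k) μ) c.1.2‖ ≤ ςD * (P.L : ℝ) ^ (k - (c.1.1 : ℕ)) := by
  have hL : (0 : ℝ) < (P.L : ℝ) := Nat.cast_pos.mpr P.L_pos
  have hj : (c.1.1 : ℕ) ≤ k := (D.le_of_lamBond c.2).trans hk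
  have hfac : (P.L : ℝ) ^ k / (P.L : ℝ) ^ (c.1.1 : ℕ) = (P.L : ℝ) ^ (k - (c.1.1 : ℕ)) := (pow_sub₀ _ hL.ne' hj).symm
  have hfac_nn : 0 ≤ (P.L : ℝ) ^ (k - (c.1.1 : ℕ)) := pow_nonneg hL.le _
  by_cases hs : c.1.2.src ∈ D.Om c.1.1
  · by_cases ht : c.1.2.tgt ∈ D.Om c.1.1
    · rw [sub_bondAvgIter_grad_eq_zero_of_mem_Om hμ _ hX c hs ht, norm_zero]
      exact mul_nonneg hς hfac_nn
    · rw [sub_bondAvgIter_grad_of_tgt_not_mem hμ _ hX c ht, norm_smul, hfac, Real.norm_of_nonneg hfac_nn, mul_comm]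
      exact mul_le_mul_of_nonneg_right ((hout c).2 ht) hfac_nn
  · rw [sub_bondAvgIter_grad_of_src_not_mem hμ _ hX c hs, norm_neg, norm_smul, hfac, Real.norm_of_nonneg hfac_nn, mul_comm]
    exact mul_le_mul_of_nonneg_right ((hout c).1 hs) hfac_nn

/-- **`Q′_j` IS A CONVEX COMBINATION, ITERATED**: `‖(Q′_jf)(y)‖ ≤ sup‖f‖` (lit-balaban `norm_siteAvg_le`, `j` times). [cite: Balaban1984PropagatorsI, (1.13) p.19, (1.20) p.20] -/
theorem norm_siteAvgIter_le_of_forall_le : ∀ (j : ℕ) (f : SiteField P 0 W) {a : ℝ}, (∀ x, ‖f x‖ ≤ a) → ∀ y : Site P j, ‖siteAvgIter j f y‖ ≤ a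
  | 0, _, _, hf, y => hf y
  | j + 1, f, _, hf, y => by
    rw [siteAvgIter_succ]
    exact norm_siteAvg_le _ (norm_siteAvgIter_le_of_forall_le j f hf) y

omit [NormedSpace ℝ W] in
/-- **THE LEVEL LIFT IS POINTWISE BOUNDED BY THE FAMILY ON THE `Λ_j`**: `‖μ_λ(x)‖ ≤ s` if `‖λ_j(y)‖ ≤ s` for every `y ∈ Λ_j` (sites), every `j` — `μ_λ(x)` IS such a value
(ym3-torus `lamSite_levOf_inOm`). [cite: Balaban1984PropagatorsII, (2.3)–(2.4) p.224; Balaban1985Variational, p.286] -/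
theorem norm_levLift_le (D : Domains P) (lam : (j : ℕ) → Site P j → W) {s : ℝ} (hs : ∀ (j : ℕ) (y : Site P j), D.LamSite j y → ‖lam j y‖ ≤ s)
    (x : Site P 0) :
    ‖lam (levOf (fun i => {z : Site P 0 | D.InOm i z}) D.k x) (iterBlockOf (levOf (fun i => {z : Site P 0 | D.InOm i z}) D.k x) x)‖ ≤ s :=
  hs _ _ (lamSite_levOf_inOm D x)

/-- ★ **THE OUTER DEFECT OF THE LEVEL LIFT IS AT MOST TWICE THE FAMILY's SIZE**: if `‖λ_j(y)‖ ≤ s` on the `Λ_j` (sites) and `‖λ_j(y′)‖ ≤ s′` at a site `y′` of `T^{(j)}`, then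
`‖λ_j(y′) − (Q′_jμ_λ)(y′)‖ ≤ s′ + s` — for the record's shear family `λ_j = log ∘ S_j(U₁)` both sizes are the (r4) letter `2σ` (`‖log S‖ ≤ 2‖S − 1‖`), so its outer defect
is `≤ 4σ`: FIRST ORDER IN THE SHEAR, as LOCATED-QFORM said, and the `ς_∂` of §2 may be taken `= 4σ`. [cite: Balaban1984PropagatorsI, (1.13) p.19, (1.20) p.20; Balaban1984PropagatorsII, (2.3)–(2.4) p.224] -/
theorem norm_sub_siteAvgIter_levLift_le (D : Domains P) (lam : (j : ℕ) → Site P j → W) {s s' : ℝ}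
    (hs : ∀ (j : ℕ) (y : Site P j), D.LamSite j y → ‖lam j y‖ ≤ s) {j : ℕ} {y : Site P j} (hy : ‖lam j y‖ ≤ s') :
    ‖lam j y - siteAvgIter j (fun x => lam (levOf (fun i => {z : Site P 0 | D.InOm i z}) D.k x)
      (iterBlockOf (levOf (fun i => {z : Site P 0 | D.InOm i z}) D.k x) x)) y‖ ≤ s' + s :=
  (norm_sub_le _ _).trans (add_le_add hy (norm_siteAvgIter_le_of_forall_le j _ (norm_levLift_le D lam hs) y))

/-- ★ **THE `hout` BINDER OF §1b ∕ §2 FOR THE LEVEL LIFT, FROM SIZES ALONE**: if `‖λ_j‖ ≤ s` on the `Λ_j`-sites and at the outer end-points of the `Λ_j`-cells, then the outer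
defect of `μ_λ` is `≤ s + s` there (no consistency asked). [cite: Balaban1984PropagatorsII, (2.3)–(2.4) p.224; Balaban1984PropagatorsI, (1.20) p.20] -/
theorem outerDefect_levLift_le_of_norm_le (D : Domains P) (lam : (j : ℕ) → Site P j → W) {s : ℝ}
    (hs : ∀ (j : ℕ) (y : Site P j), D.LamSite j y → ‖lam j y‖ ≤ s)
    (hsout : ∀ c : BondIdx D, (c.1.2.src ∉ D.Om c.1.1 → ‖lam c.1.1 c.1.2.src‖ ≤ s) ∧ (c.1.2.tgt ∉ D.Om c.1.1 → ‖lam c.1.1 c.1.2.tgt‖ ≤ s))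
    (c : BondIdx D) :
    (c.1.2.src ∉ D.Om c.1.1 → ‖lam c.1.1 c.1.2.src - siteAvgIter (c.1.1 : ℕ) (fun x => lam (levOf (fun i => {z : Site P 0 | D.InOm i z}) D.k x)
        (iterBlockOf (levOf (fun i => {z : Site P 0 | D.InOm i z}) D.k x) x)) c.1.2.src‖ ≤ s + s) ∧
    (c.1.2.tgt ∉ D.Om c.1.1 → ‖lam c.1.1 c.1.2.tgt - siteAvgIter (c.1.1 : ℕ) (fun x => lam (levOf (fun i => {z : Site P 0 | D.InOm i z}) D.k x)
        (iterBlockOf (levOf (fun i => {z : Site P 0 | D.InOm i z}) D.k x) x)) c.1.2.tgt‖ ≤ s + s) :=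
  ⟨fun h => norm_sub_siteAvgIter_levLift_le D lam hs ((hsout c).1 h), fun h => norm_sub_siteAvgIter_levLift_le D lam hs ((hsout c).2 h)⟩

end DefectSize

/-! ## §2  NODE 00's four-tori: the defect's letters from the uniform door -/

section T4

open scoped Classical in
/-- ★★ **THE R0′ SPLIT CLAUSE AT NODE 00's OBJECTS FOR A COARSE FAMILY WITH OUTER DEFECT `≤ ς_∂`** — §1 `localGaugeSplitOn_of_gauge152_coarseShift_sub` with `M := μ`
(a fine matrix gauge function reproducing the family on the `Λ_j`, e.g. FILE 5's level lift `μ_λ`), the defect's letters from FILE 3 §2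
`letters10On_extension_of_uniformDatum_adm22_T4` at the level-uniform size of §1b: there are `M_h⁰, R₀` and `C ≥ 0`, `δ₀, δ₁, B₃ > 0` such that for every height
`1 ≤ K − n`, sizes, every admissible tower `D` (`Adm22`, `D.k = K − n`) with its level weights, every window `Y` of top-level sites, every componentwise extension `H_V` of
`flatH`, every matrix family `λ = (λ_j)_j` with `Q′_jμ = λ_j` on the `Λ_j` and `‖λ_j(y_out) − Q′_jμ(y_out)‖ ≤ ς_∂` at the outer end-points, the datum `X` its coarse gradient
(factor `L^{K−n}∕L^{j(c)}`), S3's gauge `u` of `U` with potential `A` on `Y` and (152) letters `t`, the (159)-splitting `A − H_V X = A₁ + A₂ − A₃` with letters `t₁, t₂, t₃`: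
`LocalGaugeSplitOn Y η_{K−n} t (t₁ + (t₂ + t_∂) + t₃) U` for EVERY `t_∂ > 2CB₃ς_∂` (outer-consistent families: `ς_∂ = 0`, every `t_∂ > 0`).
[cite: Balaban1985Variational, (152) p.301, (157)–(159) pp.302–303, (161) p.303, (164)–(165) p.304, (168) p.304; Balaban1984PropagatorsII, (2.3) p.224, (2.35) p.228, (2.60) p.234, Cor. 2.8 (2.150)–(2.151) p.249; Balaban1984PropagatorsI, (1.20) p.20] -/
theorem localGaugeSplitOn_of_gauge152_coarseShift_outerDefect_adm22_T4 (F : T4Family) (N : ℕ) [NeZero N] :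
    ∃ (Mh₀ R₀ : ℕ) (C δ₀ δ₁ B₃ : ℝ), 0 ≤ C ∧ 0 < δ₀ ∧ 0 < δ₁ ∧ 0 < B₃ ∧
    ∀ (n K : ℕ) (_ : 1 ≤ K - n) (_ : K - n + 1 ≤ F.m + K) {Mh R a' : ℕ} (_ : Mh = F.L ^ a') (_ : Mh₀ ≤ Mh) (_ : R₀ ≤ R) (_ : a' + 3 ≤ F.m + n)
      (D : Domains (F.P K)) (_ : D.k = K - n) (_ : Adm22 D R (F.L * Mh))
      (w : ℕ → PBond (F.P K) 0 → ℝ) (_ : IsLevWeight (F.P K) (K - n) D w)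
      {Y : Set (Site (F.P K) 0)} (_ : ∀ x ∈ Y, D.InOm (K - n) x)
      {HV : (BondIdx D → MatA N) →ₗ[ℂ] (PBond (F.P K) 0 → MatA N)}
      (_ : ∀ (B : BondIdx D → MatA N) (b : PBond (F.P K) 0), HV B b = ∑ c, ((flatH (F.P K) (K - n) D (Pi.single c 1) b : ℝ) : ℂ) • B c)
      {lam : (j : ℕ) → Site (F.P K) j → MatA N} {μ : Site (F.P K) 0 → MatA N}
      (_ : ∀ (j : ℕ) (y : Site (F.P K) j), D.LamSite j y → siteAvgIter j μ y = lam j y)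
      {ςD : ℝ} (_ : 0 ≤ ςD)
      (_ : ∀ c : BondIdx D,
        (c.1.2.src ∉ D.Om c.1.1 → ‖lam c.1.1 c.1.2.src - siteAvgIter (c.1.1 : ℕ) μ c.1.2.src‖ ≤ ςD) ∧
        (c.1.2.tgt ∉ D.Om c.1.1 → ‖lam c.1.1 c.1.2.tgt - siteAvgIter (c.1.1 : ℕ) μ c.1.2.tgt‖ ≤ ςD))
      {X : BondIdx D → MatA N}
      (_ : ∀ c : BondIdx D, X c = LatticeFieldCalculus.grad (((F.P K).L : ℝ) ^ (K - n) / ((F.P K).L : ℝ) ^ (c.1.1 : ℕ)) (lam c.1.1) c.1.2)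
      {U : GaugeField (F.P K) 0 (SU N)} (u : GaugeTransf (F.P K) 0 (SU N)) {A A₁ A₂ A₃ : PBond (F.P K) 0 → MatA N} {t t₁ t₂ t₃ : ℝ}
      (_ : ∀ b ∈ (Sect2.regionOfSet (F.P K) Y).bonds,
        gaugeU (fun x => ιSU N (u x)) (fun b' => ιSU N (U b')) b = expI ((F.P K).eta (K - n)) (A b))
      (_ : ∀ b ∈ (Sect2.regionOfSet (F.P K) Y).bonds, ‖A b‖ < t)
      (_ : ∀ q ∈ (Sect2.regionOfSet (F.P K) Y).dpairs, ‖grad ((F.P K).eta (K - n)) q.2.1 (fun y => A ⟨y, q.2.2⟩) q.1‖ < t)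
      (_ : ∀ b, A b - HV X b = A₁ b + A₂ b - A₃ b)
      (_ : Letters10On Y ((F.P K).eta (K - n)) t₁ A₁) (_ : Letters10On Y ((F.P K).eta (K - n)) t₂ A₂) (_ : Letters10On Y ((F.P K).eta (K - n)) t₃ A₃)
      {tD : ℝ} (_ : 2 * C * B₃ * ςD < tD),
      LocalGaugeSplitOn Y ((F.P K).eta (K - n)) t (t₁ + (t₂ + tD) + t₃) U := by
  obtain ⟨Mh₀, R₀, C, δ₀, δ₁, B₃, hC, hδ₀, hδ₁, hB₃, hmain⟩ := letters10On_extension_of_uniformDatum_adm22_T4 F N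
  refine ⟨Mh₀, R₀, C, δ₀, δ₁, B₃, hC, hδ₀, hδ₁, hB₃, ?_⟩
  intro n K hk1 hk' Mh R a' hMha hMh hR hsize D hDk hAdm w hw Y hY HV hHV lam μ hμ ςD hς hout X hX U u A A₁ A₂ A₃ t t₁ t₂ t₃ he hA hdA h159 h₁ h₂ h₃
    tD htD
  -- the defect datum has the level-uniform size `ς_∂·L^{(K−n)−j(c)}`
  have hXD : ∀ c : BondIdx D,
      ‖(fun c => X c - bondAvgIter (c.1.1 : ℕ) (LatticeFieldCalculus.grad (((F.P K).L : ℝ) ^ (K - n)) μ) c.1.2) c‖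
        ≤ ςD * ((F.P K).L : ℝ) ^ ((K - n) - (c.1.1 : ℕ)) := fun c =>
    norm_sub_bondAvgIter_grad_le_of_outerDefect_le hμ hDk.le hX hς hout c
  have hDL : Letters10On Y ((F.P K).eta (K - n)) tD
      (HV (fun c => X c - bondAvgIter (c.1.1 : ℕ) (LatticeFieldCalculus.grad (((F.P K).L : ℝ) ^ (K - n)) μ) c.1.2)) :=
    hmain n K hk1 hk' hMha hMh hR hsize D hDk hAdm w hw hY hHV hς hXD htD
  exact localGaugeSplitOn_of_gauge152_coarseShift_sub u hHV X μ he hA hdA h159 h₁ h₂ h₃ hDL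

end T4

end Summit.QuantumFields.YangMills.BalabanUVNodes.N07SplitClauseOfCoarseShift

end
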